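import Summits.ValiantsHypothesis.ValiantsHypothesis.Theorems.FifoMatchingNNDivisionHardRowFamilies
import HarnessLib

/-!
# LOCATED ROWS — part 2/8 — §3 the zero-diagonal cube `Q∘` (✓ `…Negative.DiagTiltedLawFalse`), the pair pencil `pv i m = x_{im} − x_i − x_m` and the common located maximiser `P* = [n]∖{i,m}`

Theorems-side port (staged by val-idea-40 g5 for the desk's P-W6b hand; declaration texts VERBATIM, namespace `…Theorems.FifoMatching.LocatedRows`) of val-idea-40 g5's crux workfile `Cruxes/NNDivisionHard/LocatedRows.lean` REV 5 @4b120a7727c3 (sha16 18e097fc3d9fe11e, 1953 l.; critic of record val-idea-crit-9 g2 VERDICTS #48 / #54 / #58: VERIFIED KEEP, axioms standard), split by the 400-line cap into seven chained modules `…RowFamilies` (§1, §2, §4e-frame) → `…LocatedRowsZeroDiag` (§3) → `…LocatedRowsPairPencil` (§4) → `…LocatedRowsPinExposed` (§4b) → `…LocatedRowsColumnCoupled` (§4c) → `…LocatedRowsPermutahedron` (§4c′, §4d) → `…LocatedRowsCeiling` (§5, §5b).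

* `pv`, `val`, `val_eq`, `val_le_val_star` — for `a ⊆ [n]∖{i,m}` the tilted row `udRow a + n²·pv i m` is maximised over the vertices of `Q∘` at `P* = [n]∖{i,m}`, independently of `a`.

HONEST LABEL: helper rows for an OPEN crux (21181 `NNDivisionHard` OPEN; `ExactPencilLaw`, `allRows.Law`, COR-VIRTUAL OPEN); the `Law`s are `Prop`-valued definitions, nothing open is asserted; VP ≠ VNP is NOT proved.
-/

set_option autoImplicit false

-- the mandated summit-side namespace repeats a component by design (single-problem summit)
set_option linter.dupNamespace false

noncomputable section

open Matrix Finset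
open scoped Pointwise

namespace Summit.ValiantsHypothesis.ValiantsHypothesis.Theorems.FifoMatching.LocatedRows

open Literature.Barriers.PneNP (HasEFOfSize three_pow_le_card_mul_two_pow_of_cover_univ)
open Literature.Combinatorics.Optimization.FixedSizePsdRank (Cube bvec flat vecOuter corPolytope flat_dotProduct_vecOuter
  flat_dotProduct_le_of_mem_corPolytope)
open Summit.ValiantsHypothesis.ValiantsHypothesis.Theorems.FifoMatching.XcDivision
  (udInd udPt udRow udMat udInd_apply udInd_sq udInd_inter ud_data udRow_dotProduct_flat_diagonal flat_dotProduct_flat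
    dot_le_of_mem_convexHull)
open Summit.ValiantsHypothesis.Theorems.NNDivisionHardNegative.CliqueRowBlind (sum_udInd_mem sum_udInd_univ)
open Summit.ValiantsHypothesis.Theorems.NNDivisionHardNegative.DiagTilted
  (qOff qOffMat qOff_eq hasEFOfSize_qOff udRow_dotProduct_qOff udInd_compl udInd_univ)

/-! ## §3 The zero-diagonal cube `Q^∘`, the pair pencil, and the common located maximiser -/

section ZeroDiag
variable {n : ℕ}

/-- `⟨x_c, x_b⟩ = (Σ_{p ∈ c} 𝟙_b(p))² = |c ∩ b|²`. -/
theorem udPt_dotProduct_udPt (c b : Finset (Fin n)) :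
    udPt c ⬝ᵥ udPt b = ((c ∩ b).card : ℝ) ^ 2 := by
  classical
  have h : udPt c ⬝ᵥ udPt b = ∑ i, ∑ j, (udInd c i * udInd c j) * (udInd b i * udInd b j) := by
    show flat (fun i j => udInd c i * udInd c j) ⬝ᵥ vecOuter n (udInd b) = _
    exact flat_dotProduct_vecOuter _ _
  rw [h]
  have h2 : ∑ i, ∑ j, (udInd c i * udInd c j) * (udInd b i * udInd b j)
      = (∑ i, udInd c i * udInd b i) * (∑ j, udInd c j * udInd b j) := by
    rw [Finset.sum_mul_sum]
    refine Finset.sum_congr rfl fun i _ => Finset.sum_congr rfl fun j _ => by ring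
  rw [h2, udInd_inter, sq]

/-! The passenger is THE ZERO-DIAGONAL CUBE OF RECORD `Q∘ = conv{qOff P}` of ✓ p674104
(`Negative/DiagTiltedLawFalse.lean`, critic N18): `(q_P)_ii = 0`, `(q_P)_im = n²(1 − P_i − P_m) + n|P|` (`i ≠ m`);
`qOff_eq : q_P = n²•(x_{Pᶜ} − x_P) + n|P|•x_univ + diag(n²(2·𝟙_P − 1) − n|P|)`, `⟨udRow a, q_P⟩ = −(|a|−1)·n·(n|a| − 2n|a∩P| + |a||P|)`
(`udRow_dotProduct_qOff`), budget `hasEFOfSize_qOff : xc(Q∘) ≤ 2n`, and `diagTiltedLaw_false : ¬ diagTilted.Law`. -/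

/-- the PAIR PENCIL `pv i m = x_{{i,m}} − x_{{i}} − x_{{m}}` (`= E_im + E_mi` for `i ≠ m`). -/
def pv (i m : Fin n) : Fin (n * n) → ℝ := udPt {i, m} - udPt {i} - udPt {m}

/-- helper: `Σ_{p ∈ {i,m}} f p = f i + f m`, `Σ_{p ∈ {i}} f p = f i` packaged for `udPt` pairings. -/
theorem udPt_pair_dotProduct_udPt {i m : Fin n} (him : i ≠ m) (b : Finset (Fin n)) :
    udPt {i, m} ⬝ᵥ udPt b = (udInd b i + udInd b m) ^ 2 := by
  classical
  rw [udPt_dotProduct_udPt]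
  congr 1
  have : (({i, m} : Finset (Fin n)) ∩ b) = ({i, m} : Finset (Fin n)).filter (· ∈ b) := by
    ext x; simp [Finset.mem_filter, Finset.mem_inter]
  rw [this, Finset.card_filter, Finset.sum_pair him, udInd_apply, udInd_apply]
  push_cast
  ring

/-- `⟨x_{{i}}, x_b⟩ = 𝟙_b(i)`. -/
theorem udPt_single_dotProduct_udPt (i : Fin n) (b : Finset (Fin n)) :
    udPt {i} ⬝ᵥ udPt b = udInd b i ^ 2 := by
  classical
  rw [udPt_dotProduct_udPt, udInd_apply]
  by_cases hi : i ∈ b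
  · rw [Finset.singleton_inter_of_mem hi, Finset.card_singleton, if_pos hi]; norm_num
  · rw [Finset.singleton_inter_of_notMem hi, Finset.card_empty, if_neg hi]; norm_num

/-- ★ `⟨pv, x_b⟩ = 2·𝟙_b(i)·𝟙_b(m)`. -/
theorem pv_dotProduct_udPt {i m : Fin n} (him : i ≠ m) (b : Finset (Fin n)) :
    pv i m ⬝ᵥ udPt b = 2 * (udInd b i * udInd b m) := by
  rw [pv, sub_dotProduct, sub_dotProduct, udPt_pair_dotProduct_udPt him, udPt_single_dotProduct_udPt,
    udPt_single_dotProduct_udPt]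
  ring

/-- `⟨pv, diag d⟩ = 0` (the pencil is off-diagonal). -/
theorem pv_dotProduct_flat_diagonal {i m : Fin n} (him : i ≠ m) (d : Fin n → ℝ) :
    pv i m ⬝ᵥ flat (Matrix.diagonal d) = 0 := by
  classical
  obtain ⟨-, -, -, diag⟩ := ud_data n
  have e : ∀ c : Finset (Fin n), udPt c ⬝ᵥ flat (Matrix.diagonal d) = ∑ p ∈ c, d p := fun c => by
    rw [dotProduct_comm]; exact diag d c
  rw [pv, sub_dotProduct, sub_dotProduct, e, e, e, Finset.sum_pair him, Finset.sum_singleton, Finset.sum_singleton]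
  ring

/-- ★ `⟨pv, q_P⟩ = 2(n² + n|P| − n²(P_i + P_m))` — the pencil SEES `Q∘` (it varies with `P`). -/
theorem pv_dotProduct_qOff {i m : Fin n} (him : i ≠ m) (P : Finset (Fin n)) :
    pv i m ⬝ᵥ qOff P = 2 * ((n : ℝ) ^ 2 + (n : ℝ) * P.card - (n : ℝ) ^ 2 * (udInd P i + udInd P m)) := by
  classical
  have hu := pv_dotProduct_udPt him (Finset.univ : Finset (Fin n))
  rw [udInd_univ, udInd_univ] at hu
  have hP := pv_dotProduct_udPt him P
  have hPc := pv_dotProduct_udPt him Pᶜ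
  rw [udInd_compl, udInd_compl] at hPc
  rw [qOff_eq]
  simp only [dotProduct_sub, dotProduct_add, dotProduct_smul, smul_eq_mul]
  rw [hu, hP, hPc, pv_dotProduct_flat_diagonal him]
  ring

/-- the pencil is valid: `⟨pv, x⟩ ≤ 2 = ⟨pv, x_{{i,m}}⟩` on `COR(n)` — `pv` is maximised at the vertex `x_{{i,m}}`. -/
theorem pv_le_two {i m : Fin n} (him : i ≠ m) : ∀ x ∈ corPolytope n, pv i m ⬝ᵥ x ≤ 2 := by
  classical
  refine dot_le_of_mem_convexHull _ _ _ ?_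
  rintro _ ⟨c, rfl⟩
  show pv i m ⬝ᵥ vecOuter n (bvec c) ≤ 2
  have hc : vecOuter n (bvec c) = udPt (Finset.univ.filter fun j => c j = true) := by
    show vecOuter n (bvec c) = vecOuter n (udInd _)
    congr 1
    funext j
    rw [udInd_apply]
    simp only [Finset.mem_filter, Finset.mem_univ, true_and, bvec]
  rw [hc, pv_dotProduct_udPt him]
  have h0 := fun j => (udInd_apply (Finset.univ.filter fun j => c j = true) j)
  have hi : udInd (Finset.univ.filter fun j => c j = true) i ≤ 1 := by rw [h0]; split_ifs <;> norm_num
  have hm : udInd (Finset.univ.filter fun j => c j = true) m ≤ 1 := by rw [h0]; split_ifs <;> norm_num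
  have hi0 : 0 ≤ udInd (Finset.univ.filter fun j => c j = true) i := by rw [h0]; split_ifs <;> norm_num
  have hm0 : 0 ≤ udInd (Finset.univ.filter fun j => c j = true) m := by rw [h0]; split_ifs <;> norm_num
  nlinarith [mul_le_mul hi hm hm0 zero_le_one]

/-- `⟨pv i m, x_{{i,m}}⟩ = 2`. -/
theorem pv_dotProduct_udPt_pair {i m : Fin n} (him : i ≠ m) : pv i m ⬝ᵥ udPt {i, m} = 2 := by
  classical
  rw [pv_dotProduct_udPt him, udInd_apply, udInd_apply, if_pos (by simp), if_pos (by simp)]; ring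

/-- the tilted pencil row `ρ_a = udRow a + n²•pv` evaluated on `q_P` (`val a P`). -/
def val (i m : Fin n) (a P : Finset (Fin n)) : ℝ := (udRow a + ((n : ℝ) ^ 2) • pv i m) ⬝ᵥ qOff P

/-- closed form of the tilted row value on the vertices of `Q∘`. -/
theorem val_eq {i m : Fin n} (him : i ≠ m) (a P : Finset (Fin n)) :
    val i m a P = -(((a.card : ℝ) - 1) * n * (n * a.card - 2 * n * (a ∩ P).card + a.card * P.card))
      + (n : ℝ) ^ 2 * (2 * ((n : ℝ) ^ 2 + (n : ℝ) * P.card - (n : ℝ) ^ 2 * (udInd P i + udInd P m))) := by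
  rw [val, add_dotProduct, smul_dotProduct, smul_eq_mul, udRow_dotProduct_qOff, pv_dotProduct_qOff him]

/-- ★ **THE COMMON LOCATED MAXIMISER.**  For every row `a ⊆ [n] ∖ {i,m}` the tilted pencil row `udRow a + n²•pv` is maximised
over `Q∘` at `P* = [n] ∖ {i,m}` — ONE chamber for the whole located block. -/
theorem val_le_val_star {i m : Fin n} (him : i ≠ m) {a : Finset (Fin n)} (ha : a ⊆ ({i, m} : Finset (Fin n))ᶜ)
    (P : Finset (Fin n)) : val i m a P ≤ val i m a ({i, m} : Finset (Fin n))ᶜ := by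
  classical
  rw [val_eq him, val_eq him]
  -- data of P* = {i,m}ᶜ
  have hpair : (({i, m} : Finset (Fin n))).card = 2 := Finset.card_pair him
  have hn2 : 2 ≤ n := by
    have := Finset.card_le_univ ({i, m} : Finset (Fin n)); rw [hpair, Fintype.card_fin] at this; exact this
  have hstar_card : ((({i, m} : Finset (Fin n))ᶜ).card : ℝ) = n - 2 := by
    rw [Finset.card_compl, hpair, Fintype.card_fin, Nat.cast_sub hn2]; norm_num
  have hstar_inter : a ∩ ({i, m} : Finset (Fin n))ᶜ = a := Finset.inter_eq_left.2 ha
  have hstar_i : udInd (({i, m} : Finset (Fin n))ᶜ) i = 0 := by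
    rw [udInd_apply, if_neg (by simp)]
  have hstar_m : udInd (({i, m} : Finset (Fin n))ᶜ) m = 0 := by
    rw [udInd_apply, if_neg (by simp)]
  rw [hstar_card, hstar_inter, hstar_i, hstar_m]
  -- data of P: u = P_i + P_m, p' = |P ∩ {i,m}ᶜ|, t = |a ∩ P|
  set k : ℝ := (a.card : ℝ) with hk
  set t : ℝ := ((a ∩ P).card : ℝ) with ht
  set p' : ℝ := ((P ∩ ({i, m} : Finset (Fin n))ᶜ).card : ℝ) with hp'
  have hu_eq : ((P ∩ ({i, m} : Finset (Fin n))).card : ℝ) = udInd P i + udInd P m := by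
    have : P ∩ ({i, m} : Finset (Fin n)) = ({i, m} : Finset (Fin n)).filter (· ∈ P) := by
      ext x; simp only [Finset.mem_inter, Finset.mem_filter]; tauto
    rw [this, Finset.card_filter, Finset.sum_pair him, udInd_apply, udInd_apply]; push_cast; ring
  have hsplit : (P.card : ℝ) = p' + (udInd P i + udInd P m) := by
    rw [← hu_eq, hp']
    have h := Finset.card_filter_add_card_filter_not (s := P) (fun x => x ∈ (({i, m} : Finset (Fin n))ᶜ))
    have e1 : P.filter (fun x => x ∈ (({i, m} : Finset (Fin n))ᶜ)) = P ∩ ({i, m} : Finset (Fin n))ᶜ := by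
      ext x; simp only [Finset.mem_filter, Finset.mem_inter]
    have e2 : P.filter (fun x => ¬ x ∈ (({i, m} : Finset (Fin n))ᶜ)) = P ∩ ({i, m} : Finset (Fin n)) := by
      ext x; simp only [Finset.mem_filter, Finset.mem_inter, Finset.mem_compl, not_not]
    rw [e1, e2] at h
    have := congrArg (fun z : ℕ => (z : ℝ)) h
    push_cast at this
    linarith
  have hPi0 : 0 ≤ udInd P i := by rw [udInd_apply]; split_ifs <;> norm_num
  have hPm0 : 0 ≤ udInd P m := by rw [udInd_apply]; split_ifs <;> norm_num
  have htk : t ≤ k := by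
    rw [ht, hk]; exact_mod_cast Finset.card_le_card Finset.inter_subset_left
  have htp : t ≤ p' := by
    rw [ht, hp']
    exact_mod_cast Finset.card_le_card (Finset.subset_inter Finset.inter_subset_right
      ((Finset.inter_subset_left).trans ha))
  have hkn : k ≤ n - 2 := by
    rw [hk, ← hstar_card]; exact_mod_cast Finset.card_le_card ha
  have hpn : p' ≤ n - 2 := by
    rw [hp', ← hstar_card]; exact_mod_cast Finset.card_le_card Finset.inter_subset_right
  have ht0 : 0 ≤ t := by rw [ht]; exact Nat.cast_nonneg _
  have hk0 : 0 ≤ k := by rw [hk]; exact Nat.cast_nonneg _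
  have hn0 : (0 : ℝ) ≤ n := Nat.cast_nonneg _
  -- (k-1)(k-t) ≥ 0 over the naturals
  have hkt : 0 ≤ (k - 1) * (k - t) := by
    rcases Nat.eq_zero_or_pos a.card with h0 | hpos
    · have hk0' : k = 0 := by rw [hk, h0, Nat.cast_zero]
      have ht0' : t = 0 := le_antisymm (hk0' ▸ htk) ht0
      rw [hk0', ht0']; norm_num
    · have hk1 : 1 ≤ k := by rw [hk]; exact_mod_cast hpos
      exact mul_nonneg (by linarith) (by linarith)
  rw [hsplit]
  set u : ℝ := udInd P i + udInd P m with hu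
  have hu0 : 0 ≤ u := by rw [hu]; exact add_nonneg hPi0 hPm0
  have hkk : k * (k - 1) ≤ 2 * (n : ℝ) ^ 2 := by nlinarith
  have h1 : 0 ≤ 2 * (n : ℝ) ^ 2 * ((k - 1) * (k - t)) := by positivity
  have h2 : 0 ≤ n * ((n : ℝ) - 2 - p') * (2 * (n : ℝ) ^ 2 - k * (k - 1)) :=
    mul_nonneg (mul_nonneg hn0 (by linarith)) (by linarith)
  have hn1 : (1 : ℝ) ≤ n := by exact_mod_cast (show 1 ≤ n by omega)
  have h3 : 0 ≤ u * (n * (k * (k - 1)) + 2 * (n : ℝ) ^ 3 * ((n : ℝ) - 1)) := by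
    refine mul_nonneg hu0 (add_nonneg ?_ ?_)
    · rcases Nat.eq_zero_or_pos a.card with h0 | hpos
      · have hk0' : k = 0 := by rw [hk, h0, Nat.cast_zero]
        rw [hk0']; norm_num
      · have hk1 : 1 ≤ k := by rw [hk]; exact_mod_cast hpos
        exact mul_nonneg hn0 (mul_nonneg hk0 (by linarith))
    · exact mul_nonneg (by positivity) (by linarith)
  linarith [h1, h2, h3]

end ZeroDiag

end Summit.ValiantsHypothesis.ValiantsHypothesis.Theorems.FifoMatching.LocatedRows
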